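import Literature.NumberTheory.LFunctions.ThetaChainSound
import Literature.NumberTheory.LFunctions.PrimeNumberTheoremErrorRHExplicitProofs
import HarnessLib

/-!
# RH-CONDITIONAL (the window itself is RH-FREE) — Lee–Nosal 2026, Theorem 1.2 (`θ`): the window `2657 ≤ x ≤ 3511` by kernel computation, hence `|θ(x) − x| ≤ √x log x (log x − log log x)/(8π)` for ALL `x ≥ 2657` under RH modulo Büthe («nothing here bears on the truth of RH»)

Topic `Literature/NumberTheory/LFunctions` (RH literature-typing tranche 1, gen 10). Labels: the
finite-range certificate `abs_theta_sub_le_window` is **RH-FREE** (a statement about the primes below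
`3511`); the assembled theorem `LeeNosal2026_theta_of_buthe` is **RH-CONDITIONAL**. No named facts;
the `def`s are computable checker functions and one constant. Nothing here bears on the truth of RH.

`PrimeNumberTheoremErrorRHExplicitProofs.lean` proves Lee–Nosal's Theorem 1.2 (J. Number Theory 283
(2026), Thm. 1.2: under RH `|θ(x) − x| ≤ 𝓑(x) = √x log x (log x − log log x)/(8π)` for `x ≥ 2657`) for
`x ≥ 10¹⁴` by the explicit formula and for `x ≥ 3500` modulo Büthe's Theorem 2
(`LeeNosalThm12.theta_of_buthe`). The printed threshold `2657` is where the inequality starts to hold;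
the window `2657 ≤ x < 3500` is a finite statement about `θ` ("numerical computations confirm the
result in the remaining range", loc. cit. §3.3), settled here by a kernel computation:

* `abs_theta_sub_le_window`: `|θ(x) − x| ≤ 𝓑(x)` for all real `2657 ≤ x ≤ 3511`, unconditionally;
* **`LeeNosal2026_theta_of_buthe (hB : Buthe2018_thm2_theta) (hRH : RiemannHypothesis) :
  ∀ x ≥ 2657, |θ(x) − x| ≤ 𝓑(x)`** — the `θ`-line of `LeeNosal2026_thm12` on its full printed range,
  modulo Büthe's unconditional computer-assisted bound.

METHOD. The `θ`-chain of `ThetaChainCheck.lean`/`ThetaChainSound.lean` (states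
`⟨p, Llo, Lhi, Tlo, Thi⟩` with `Llo ≤ 2⁸⁰ log p ≤ Lhi`, `Tlo ≤ 2⁸⁰ θ(p) ≤ Thi`, walking the complete
prime table `ChainTable.table`, primality by `ThetaChain.primeChk`, logarithms by `ThetaChain.logNext`)
with Schoenfeld's comparison `chkB` replaced by `chkLN`: `D ≤ 2⁸⁰ √p ℓ(ℓ − M)/(8π)` tested after
squaring in `ℕ`, where `ℓ = Llo/2⁸⁰ ≤ log p` and `M = MHI/2⁸⁰ = 2.0998 ≥ log log p` for `p ≤ 3511`
(`loglog_le_MHI`, kernel enclosures of `log 3511`, `log 81637`, `log 10000`), so that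
`√p ℓ(ℓ − M) ≤ √p log p (log p − log log p)` (`chkLN_sound`); thresholds `599 ↦ 2657` (a prime). The
invariant (`Inv`, `step_inv`, `run_sound`, `initS_inv`) is that of `ThetaChainSound` verbatim with
`𝓑` (non-decreasing on `[e, ∞)`, `bound_mono`) in place of `√x log² x/(8π)`; on each `[p, p')` the
two one-sided checks at `p` and the right end give `|θ(x) − x| ≤ 𝓑(p) ≤ 𝓑(x)`. The run: `489` steps
from `ThetaChain.initS` (the prime `2`) to the prime `3511` (`runLN`, `decide +kernel`, standard
axioms, under a second of kernel time); the comparison has `≥ 1.2 %` to spare on every cell (the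
tightest is `[3271, 3299)`).

TODO (the `ψ`-line below `350`): the analogous run of `SchoenfeldPsiTable.PsiChain` on `101 ≤ x < 350`
needs the comparison at every integer with `√n` (not `√q`) and a finer piecewise bound for `log log`;
not done here.

## References

* E. S. Lee, P. Nosal, *Sharper bounds for the error in the prime number theorem assuming the Riemann
  Hypothesis*, J. Number Theory 283 (2026) 241–258, Thm. 1.2 and §3.3. [LeeNosal2026]
* J. Büthe, *An analytic method for bounding ψ(x)*, Math. Comp. 87 (2018), 1991–2009, Thm. 2. [Buthe2018]
* L. Schoenfeld, Math. Comp. 30 (1976), 337–360, Thm. 10 (the chain certifies his (6.3) in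
  `ThetaChain*`; here its Lee–Nosal variant). [Schoenfeld1976]
-/

namespace Literature.NumberTheory.LFunctions.LeeNosalThetaChain

open ThetaChain ChainCheck ChainTable

/-! ### The checker: the `θ`-chain of `ThetaChainCheck` with the Lee–Nosal comparison -/

/-- `MHI = ⌈2⁸⁰ · 2.0998⌉`, an upper enclosure of `2⁸⁰ log log x` for `x ≤ 3513`
(`log log 3511 = 2.09969…`). [cite: LeeNosal2026, Thm. 1.2 (finite-range certificate)] -/
def MHI : ℕ := 2538502436026798341048029

/-- `chkLN D p Llo`: `p ≤ 3511`, `Llo ≥ MHI + 2⁸⁰` and `D²·2¹⁶⁰·6316548210 ≤ p·Llo²·(Llo − MHI)²·10⁷`; since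
`64π² < 631.654821`, it implies `D ≤ 2⁸⁰ √p ℓ(ℓ − M)/(8π)` with `ℓ = Llo/2⁸⁰`, `M = MHI/2⁸⁰`
(`chkLN_sound`). [cite: LeeNosal2026, Thm. 1.2 (finite-range certificate)] -/
def chkLN (D p Llo : ℕ) : Bool :=
  Nat.ble p 3511 && Nat.ble (Nat.add MHI SC) Llo &&
    Nat.ble (Nat.mul (Nat.mul (Nat.mul D D) P160) 6316548210)
      (Nat.mul (Nat.mul (Nat.mul p (Nat.mul Llo Llo)) (Nat.mul (Nat.sub Llo MHI) (Nat.sub Llo MHI)))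
        10000000)

/-- **One step** of the Lee–Nosal `θ`-chain to the next table entry `p'`: as `ThetaChain.step`, with
the comparisons `chkLN` performed once `p ≥ 2657` (right end of `[p, p')`) and `p' ≥ 2657` (at `p'`).
[cite: LeeNosal2026, Thm. 1.2 (finite-range certificate)] -/
def step (s : TS) (p' : ℕ) : Option TS :=
  match s with
  | ⟨p, Llo, Lhi, Tlo, Thi⟩ =>
    bif !(Nat.blt p p' && Nat.beq (Nat.mod p' 2) 1 && primeChk p') then none else
    bif !(Nat.blt p 2657 || chkLN (Nat.sub (Nat.mul SC p') Tlo) p Llo) then none else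
    match logNext p Llo Lhi p' with
    | none => none
    | some (Llo', Lhi') =>
      let Tlo' := Nat.add Tlo Llo'
      let Thi' := Nat.add Thi Lhi'
      bif !(Nat.blt p' 2657 || chkLN (Nat.sub Thi' (Nat.mul SC p')) p' Llo') then none
      else some ⟨p', Llo', Lhi', Tlo', Thi'⟩

/-- Run over a segment of the table with fuel (as `ThetaChain.run`, with `step`).
[cite: LeeNosal2026, Thm. 1.2 (finite-range certificate)] -/
def run : ℕ → TS → List ℕ → Option TS
  | 0, s, _ => some s
  | _ + 1, s, [] => some s
  | fuel + 1, s, p' :: rest =>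
    match step s p' with
    | none => none
    | some s' => run fuel s' rest


/-! ### The certified run: `489` steps, primes `2` to `3511` -/

/-- **The certified Lee–Nosal `θ`-run** from `ThetaChain.initS` (the prime `2`) over the first `489`
entries of `ChainTable.table` after `2`, ending at the prime `3511` (the expected state was obtained
by evaluating the same function compiled). [cite: LeeNosal2026, Thm. 1.2] -/
theorem runLN :
    run 489 initS (after initS.p table) =
      some ⟨3511, 9869254733826215157994338, 9869254733826690763892372,
        4131650075971110447181871219, 4131650075971342542854206493⟩ := by
  decide +kernel

end Literature.NumberTheory.LFunctions.LeeNosalThetaChain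

/-! ## Soundness -/

noncomputable section

namespace Literature.NumberTheory.LFunctions.LeeNosalThetaChain

open ThetaChain ChainCheck ChainTable Real Finset
open scoped Chebyshev

/-! ### The Lee–Nosal bound is non-decreasing on `[e, ∞)` -/

/-- `𝓑(x) = √x log x (log x − log log x)/(8π)` is non-decreasing on `[e, ∞)` (each of `√x`, `log x`,
`log x − log log x` is, the last since `log b − log a ≤ b − a` for `1 ≤ a ≤ b`).
[cite: LeeNosal2026, Thm. 1.2 (the bound `𝓑`)] -/
theorem bound_mono {x y : ℝ} (hx : Real.exp 1 ≤ x) (hxy : x ≤ y) :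
    LeeNosal2026.bound x ≤ LeeNosal2026.bound y := by
  rw [LeeNosal2026.bound_def, LeeNosal2026.bound_def]
  have hπ := Real.pi_pos
  have hx0 : 0 < x := (Real.exp_pos 1).trans_le hx
  have hLx : 1 ≤ Real.log x := (Real.le_log_iff_exp_le hx0).2 hx
  have hLxy : Real.log x ≤ Real.log y := Real.log_le_log hx0 hxy
  have h1 : Real.log (Real.log y) - Real.log (Real.log x) ≤ Real.log y - Real.log x := by
    rw [← Real.log_div (by linarith) (by linarith)]
    have h := Real.log_le_sub_one_of_pos (show 0 < Real.log y / Real.log x from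
      div_pos (by linarith) (by linarith))
    have h2 : Real.log y / Real.log x - 1 ≤ Real.log y - Real.log x := by
      rw [div_sub_one (by linarith), div_le_iff₀ (by linarith)]
      nlinarith
    linarith
  have h3 : 0 ≤ Real.log x - Real.log (Real.log x) := by
    have := Real.log_le_sub_one_of_pos (show 0 < Real.log x by linarith); linarith
  apply div_le_div_of_nonneg_right _ (by positivity)
  have h4 : Real.sqrt x * Real.log x ≤ Real.sqrt y * Real.log y :=
    mul_le_mul (Real.sqrt_le_sqrt hxy) hLxy (by linarith) (Real.sqrt_nonneg _)
  exact mul_le_mul h4 (by linarith) h3 (mul_nonneg (Real.sqrt_nonneg _) (by linarith))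

/-! ### Soundness of the comparison -/

/-- `2⁸⁰ log log p ≤ MHI` for `1 < p ≤ 3511` (`log 3511 ≤ 8.1637`, `log 8.1637 ≤ 2.0997`, kernel
enclosures). [folklore] -/
private theorem loglog_le_MHI {p : ℕ} (hp1 : 1 < p) (hp : p ≤ 3511) :
    2 ^ 80 * Real.log (Real.log p) ≤ (MHI : ℝ) := by
  have h1 : Literature.Analysis.SpecialFunctions.KernelLog.logIv 3511 =
      some (9869254733826213686136626, 9869254733826689292394534) := by decide +kernel
  have h2 : Literature.Analysis.SpecialFunctions.KernelLog.logIv 81637 =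
      some (13672996801325010812974709, 13672996801325486419426049) := by decide +kernel
  have h3 : Literature.Analysis.SpecialFunctions.KernelLog.logIv 10000 =
      some (11134618283120777461109716, 11134618283121253067415982) := by decide +kernel
  have hA := (Literature.Analysis.SpecialFunctions.KernelLog.logIv_sound h1).2
  have hB := (Literature.Analysis.SpecialFunctions.KernelLog.logIv_sound h2).2
  have hC := (Literature.Analysis.SpecialFunctions.KernelLog.logIv_sound h3).1
  simp only [Nat.cast_ofNat] at hA hB hC
  have hp1R : (1 : ℝ) < p := by exact_mod_cast hp1
  have hpR : (p : ℝ) ≤ 3511 := by exact_mod_cast hp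
  have hlogp : Real.log p ≤ 81637 / 10000 := by
    have := Real.log_le_log (by linarith) hpR
    norm_num at hA ⊢
    linarith
  have hlogp0 : 0 < Real.log p := Real.log_pos hp1R
  have hll : Real.log (Real.log p) ≤ Real.log 81637 - Real.log 10000 := by
    rw [← Real.log_div (by norm_num) (by norm_num)]
    exact Real.log_le_log hlogp0 hlogp
  norm_num [MHI] at hB hC ⊢
  linarith

/-- **Soundness of `chkLN`**: if `chkLN D p Llo` holds and `Llo ≤ 2⁸⁰ log p` (`p ≥ 1`), then
`D ≤ 2⁸⁰ · 𝓑(p)`, `𝓑(p) = √p log p (log p − log log p)/(8π)`.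
[cite: LeeNosal2026, Thm. 1.2 (finite-range certificate)] -/
theorem chkLN_sound {D p Llo : ℕ} (h : chkLN D p Llo = true) (hp : 1 ≤ p)
    (hL : (Llo : ℝ) ≤ 2 ^ 80 * Real.log p) :
    (D : ℝ) ≤ 2 ^ 80 * LeeNosal2026.bound p := by
  have hπ := Real.pi_pos
  simp only [chkLN, Bool.and_eq_true, Nat.ble_eq, Nat.add_eq, Nat.mul_eq, Nat.sub_eq] at h
  obtain ⟨⟨hp3511, hMS⟩, hble⟩ := h
  have hM : MHI ≤ Llo := le_trans (Nat.le_add_right _ _) hMS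
  have hR : (D : ℝ) * D * 2 ^ 160 * 6316548210 ≤
      (p : ℝ) * ((Llo : ℝ) * Llo) * (((Llo : ℝ) - MHI) * ((Llo : ℝ) - MHI)) * 10000000 := by
    rw [P160_eq] at hble
    have := hble
    rw [← Nat.cast_sub hM] 
    exact_mod_cast this
  have hSC : ((MHI : ℝ) + 2 ^ 80) ≤ Llo := by
    rw [← SC_real]; exact_mod_cast hMS
  have hp1 : 1 < p := by
    by_contra hh
    have hp' : p = 1 := by omega
    subst hp'
    simp only [Nat.cast_one, Real.log_one, mul_zero] at hL
    have : (0 : ℝ) ≤ MHI := Nat.cast_nonneg _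
    linarith
  have hMHI := loglog_le_MHI hp1 hp3511
  have hpR : (1 : ℝ) ≤ p := by exact_mod_cast hp
  -- a real name for the constant `MHI`
  obtain ⟨M, hMdef⟩ : ∃ M : ℝ, M = (MHI : ℝ) := ⟨_, rfl⟩
  rw [← hMdef] at hR hSC hMHI
  have hℓM0 : (0 : ℝ) ≤ (Llo : ℝ) - M := by linarith
  have hLlo0 : (0 : ℝ) ≤ Llo := Nat.cast_nonneg _
  have h2_80 : (0 : ℝ) ≤ 2 ^ 80 := pow_nonneg zero_le_two 80
  have ha : (0 : ℝ) ≤ (D : ℝ) * 2 ^ 80 * (8 * Real.pi) :=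
    mul_nonneg (mul_nonneg (Nat.cast_nonneg _) h2_80) (by linarith)
  have hb : (0 : ℝ) ≤ Real.sqrt p * ((Llo : ℝ) * ((Llo : ℝ) - M)) :=
    mul_nonneg (Real.sqrt_nonneg _) (mul_nonneg hLlo0 hℓM0)
  -- `(D·2⁸⁰·8π)² ≤ p·Llo²·(Llo − M)²`
  have h1 : ((D : ℝ) * 2 ^ 80 * (8 * Real.pi)) ^ 2 ≤
      (p : ℝ) * ((Llo : ℝ) * ((Llo : ℝ) - M)) ^ 2 := by
    have e : ((D : ℝ) * 2 ^ 80 * (8 * Real.pi)) ^ 2 =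
        (D : ℝ) * D * 2 ^ 160 * (64 * Real.pi ^ 2 * 10000000) / 10000000 := by ring
    rw [e, div_le_iff₀ (by norm_num)]
    have e' : (p : ℝ) * ((Llo : ℝ) * Llo) * (((Llo : ℝ) - M) * ((Llo : ℝ) - M)) * 10000000 =
        (p : ℝ) * ((Llo : ℝ) * ((Llo : ℝ) - M)) ^ 2 * 10000000 := by ring
    calc (D : ℝ) * D * 2 ^ 160 * (64 * Real.pi ^ 2 * 10000000)
        ≤ (D : ℝ) * D * 2 ^ 160 * 6316548210 := by
          apply mul_le_mul_of_nonneg_left pi_sq_bound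
          exact mul_nonneg (mul_nonneg (Nat.cast_nonneg _) (Nat.cast_nonneg _))
            (pow_nonneg zero_le_two 160)
      _ ≤ (p : ℝ) * ((Llo : ℝ) * Llo) * (((Llo : ℝ) - M) * ((Llo : ℝ) - M)) * 10000000 := hR
      _ = (p : ℝ) * ((Llo : ℝ) * ((Llo : ℝ) - M)) ^ 2 * 10000000 := e'
  have e2 : (Real.sqrt p * ((Llo : ℝ) * ((Llo : ℝ) - M))) ^ 2 =
      (p : ℝ) * ((Llo : ℝ) * ((Llo : ℝ) - M)) ^ 2 := by
    rw [mul_pow, Real.sq_sqrt (Nat.cast_nonneg _)]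
  have h3 : ((D : ℝ) * 2 ^ 80 * (8 * Real.pi)) ^ 2 ≤
      (Real.sqrt p * ((Llo : ℝ) * ((Llo : ℝ) - M))) ^ 2 := by rw [e2]; exact h1
  have h4 : (D : ℝ) * 2 ^ 80 * (8 * Real.pi) ≤ Real.sqrt p * ((Llo : ℝ) * ((Llo : ℝ) - M)) :=
    (pow_le_pow_iff_left₀ ha hb two_ne_zero).1 h3
  -- `Llo (Llo − M) ≤ 2¹⁶⁰ log p (log p − log log p)`
  have h5 : (Llo : ℝ) * ((Llo : ℝ) - M) ≤
      (2 ^ 80 * Real.log p) * (2 ^ 80 * (Real.log p - Real.log (Real.log p))) := by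
    apply mul_le_mul hL _ hℓM0 (mul_nonneg h2_80 (Real.log_nonneg hpR))
    linarith
  have h6 : (D : ℝ) * 2 ^ 80 * (8 * Real.pi) ≤
      Real.sqrt p * ((2 ^ 80 * Real.log p) * (2 ^ 80 * (Real.log p - Real.log (Real.log p)))) :=
    h4.trans (mul_le_mul_of_nonneg_left h5 (Real.sqrt_nonneg _))
  rw [LeeNosal2026.bound_def]
  have h7 : (D : ℝ) ≤ Real.sqrt p * ((2 ^ 80 * Real.log p) *
      (2 ^ 80 * (Real.log p - Real.log (Real.log p)))) / (2 ^ 80 * (8 * Real.pi)) := by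
    rw [le_div_iff₀ (mul_pos (pow_pos two_pos 80) (by linarith))]
    linarith [h6]
  have e8 : Real.sqrt p * ((2 ^ 80 * Real.log p) *
      (2 ^ 80 * (Real.log p - Real.log (Real.log p)))) / (2 ^ 80 * (8 * Real.pi)) =
      2 ^ 80 * (Real.sqrt p * Real.log p * (Real.log p - Real.log (Real.log p)) / (8 * Real.pi)) := by
    field_simp
  linarith [h7, e8]

/-! ### The inequality on one interval `[p, p')` -/

/-- From `θ ≡ θ(p)` on `[p, p')`, `θ(p) − p ≤ 𝓑(p)`, `p' − θ(p) ≤ 𝓑(p)` and `p ≥ 3`: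
`|θ(x) − x| ≤ 𝓑(x)` for `p ≤ x < p'`. [cite: LeeNosal2026, Thm. 1.2] -/
theorem abs_theta_sub_le_Ico {p p' : ℕ} (hp3 : 3 ≤ p)
    (hq : ∀ q : ℕ, p < q → q < p' → ¬ q.Prime)
    (hleft : θ (p : ℝ) - p ≤ LeeNosal2026.bound p)
    (hright : (p' : ℝ) - θ (p : ℝ) ≤ LeeNosal2026.bound p) {x : ℝ}
    (hpx : (p : ℝ) ≤ x) (hxp : x < p') : |θ x - x| ≤ LeeNosal2026.bound x := by
  have hp3R : (3 : ℝ) ≤ p := by exact_mod_cast hp3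
  have he : Real.exp 1 ≤ (p : ℝ) := le_trans Real.exp_one_lt_d9.le (by linarith)
  have hB : LeeNosal2026.bound p ≤ LeeNosal2026.bound x := bound_mono he hpx
  rw [theta_real_eq hq hpx hxp, abs_sub_le_iff]
  constructor <;> linarith

/-! ### The invariant -/

/-- **The invariant** of a state of the Lee–Nosal `θ`-chain (as `ThetaChain.Inv`, with the bound `𝓑`
and the threshold `2657`). [cite: LeeNosal2026, Thm. 1.2 (finite-range certificate)] -/
structure Inv (s : TS) : Prop where
  /-- the prime reached is a table entry -/
  mem : s.p ∈ table
  /-- and is prime -/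
  prime : s.p.Prime
  /-- `Llo ≤ 2⁸⁰ log p` -/
  Llo_le : (s.Llo : ℝ) ≤ 2 ^ 80 * Real.log s.p
  /-- `2⁸⁰ log p ≤ Lhi` -/
  le_Lhi : 2 ^ 80 * Real.log s.p ≤ s.Lhi
  /-- `Tlo ≤ 2⁸⁰ θ(p)` -/
  Tlo_le : (s.Tlo : ℝ) ≤ 2 ^ 80 * θ (s.p : ℝ)
  /-- `2⁸⁰ θ(p) ≤ Thi` -/
  le_Thi : 2 ^ 80 * θ (s.p : ℝ) ≤ s.Thi
  /-- the bound above at `p`: `θ(p) − p ≤ 𝓑(p)` once `p ≥ 2657` -/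
  left : 2657 ≤ s.p → θ (s.p : ℝ) - s.p ≤ LeeNosal2026.bound s.p
  /-- the bound below at `p`: `p − θ(p) ≤ 𝓑(p)` once `p > 2657` -/
  right : 2657 < s.p → (s.p : ℝ) - θ (s.p : ℝ) ≤ LeeNosal2026.bound s.p
  /-- the Lee–Nosal inequality below `p` -/
  ln : ∀ x : ℝ, 2657 ≤ x → x < s.p → |θ x - x| ≤ LeeNosal2026.bound x

/-! ### One step -/

/-- `2657` is prime. [folklore] -/
private theorem prime_2657 : Nat.Prime 2657 := by norm_num

/-- **Soundness of one step.** If `Inv s` holds, `p'` is the table successor of `s.p`, and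
`step s p' = some s'`, then `Inv s'` and `s'.p = p'`. [cite: LeeNosal2026, Thm. 1.2] -/
theorem step_inv {s s' : TS} (hI : Inv s) {p' : ℕ} {rest : List ℕ}
    (hafter : after s.p table = p' :: rest) (h : step s p' = some s') : Inv s' ∧ s'.p = p' := by
  have hT := tableOK
  obtain ⟨p, Llo, Lhi, Tlo, Thi⟩ := s
  simp only at hafter hI
  obtain ⟨hmem, hprime, hLlo, hLhi, hTlo, hThi, hleft, hright, hsch⟩ := hI
  simp only at hmem hprime hLlo hLhi hTlo hThi hleft hright hsch
  -- the successor `p'`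
  obtain ⟨hp'T, hpp', hmin⟩ := head_after hT.sorted hafter
  have hp'le : p' ≤ 4599989 := hT.bounded p' hp'T
  have hnoprime : ∀ q : ℕ, p < q → q < p' → ¬ q.Prime := fun q h1 h2 hq =>
    absurd (hmin q (hT.complete q hq (by omega)) h1) (not_le.2 h2)
  have hp1 : 1 ≤ p := hprime.one_lt.le
  have hp0 : 0 < p := hprime.pos
  -- unfold the step
  simp only [step, Nat.mul_eq, Nat.sub_eq, Nat.add_eq] at h
  obtain ⟨hg1, h⟩ := bif_not_none h
  simp only [Bool.and_eq_true] at hg1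
  obtain ⟨⟨-, hodd⟩, hchk⟩ := hg1
  have hodd' : Odd p' := Nat.odd_iff.2 (Nat.eq_of_beq_eq_true hodd)
  have hp'prime : p'.Prime := primeChk_sound hchk hodd' (by omega)
  obtain ⟨hg2, h⟩ := bif_not_none h
  rcases hln : logNext p Llo Lhi p' with _ | ⟨Llo', Lhi'⟩
  · rw [hln] at h; simp at h
  · rw [hln] at h
    simp only at h
    obtain ⟨hg3, h⟩ := bif_not_none h
    simp only [Option.some.injEq] at h
    subst h
    -- the new enclosures
    obtain ⟨hLlo', hLhi'⟩ := logNext_sound hln hp0 hpp'.le hLlo hLhi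
    have hθ' : θ (p' : ℝ) = θ (p : ℝ) + Real.log p' := theta_succ_prime hp'prime hpp' hnoprime
    have hθmono : θ (p : ℝ) ≤ θ (p' : ℝ) := Chebyshev.theta_mono (by exact_mod_cast hpp'.le)
    have hpp'R : (p : ℝ) ≤ p' := by exact_mod_cast hpp'.le
    -- the right-end check (when `p ≥ 2657`)
    have hrightEnd : 2657 ≤ p → (p' : ℝ) - θ (p : ℝ) ≤ LeeNosal2026.bound p := by
      intro h2657
      simp only [Bool.or_eq_true, Nat.blt_eq] at hg2
      rcases hg2 with hlt | hc
      · omega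
      · have hD := chkLN_sound hc hp1 hLlo
        have h1 : (SC : ℝ) * p' - Tlo ≤ ((SC * p' - Tlo : ℕ) : ℝ) := by
          have := real_sub_le_natSub (SC * p') Tlo
          push_cast at this ⊢
          exact this
        rw [SC_real] at h1
        have h2 : 2 ^ 80 * ((p' : ℝ) - θ (p : ℝ)) ≤ 2 ^ 80 * LeeNosal2026.bound p := by
          nlinarith
        exact le_of_mul_le_mul_left h2 (by positivity)
    -- the check at `p'` (when `p' ≥ 2657`)
    have hleftNew : 2657 ≤ p' → θ (p' : ℝ) - p' ≤ LeeNosal2026.bound p' := by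
      intro h2657
      simp only [Bool.or_eq_true, Nat.blt_eq] at hg3
      rcases hg3 with hlt | hc
      · omega
      · have hD := chkLN_sound hc (hp1.trans hpp'.le) hLlo'
        have h1 : ((Thi : ℝ) + Lhi') - SC * p' ≤ ((Thi + Lhi' - SC * p' : ℕ) : ℝ) := by
          have := real_sub_le_natSub (Thi + Lhi') (SC * p')
          push_cast at this ⊢
          exact this
        rw [SC_real] at h1
        have h2 : 2 ^ 80 * (θ (p' : ℝ) - p') ≤ 2 ^ 80 * LeeNosal2026.bound p' := by
          rw [hθ']; nlinarith
        exact le_of_mul_le_mul_left h2 (by positivity)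
    -- if `p < 2657` then `p' ≤ 2657`
    have h2657 : p < 2657 → p' ≤ 2657 := fun hlt =>
      hmin 2657 (hT.complete 2657 prime_2657 (by norm_num)) hlt
    refine ⟨⟨hp'T, hp'prime, hLlo', hLhi', ?_, ?_, hleftNew, ?_, ?_⟩, rfl⟩
    · simp only; rw [hθ']; push_cast; linarith
    · simp only; rw [hθ']; push_cast; linarith
    · -- right at `p'`
      intro h2657'
      simp only at h2657' ⊢
      have hp2657 : 2657 ≤ p := by
        by_contra hh
        push Not at hh
        have := h2657 hh
        omega
      have h1 := hrightEnd hp2657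
      have he : Real.exp 1 ≤ (p : ℝ) := by
        have : (2657 : ℝ) ≤ p := by exact_mod_cast hp2657
        linarith [Real.exp_one_lt_d9]
      have h2 : LeeNosal2026.bound p ≤ LeeNosal2026.bound p' := bound_mono he hpp'R
      linarith
    · -- Lee–Nosal below `p'`
      intro x hx hxp'
      simp only at hxp'
      by_cases hxp : x < p
      · exact hsch x hx hxp
      · push Not at hxp
        have hp2657 : 2657 ≤ p := by
          by_contra hh
          push Not at hh
          have := h2657 hh
          have : (p' : ℝ) ≤ 2657 := by exact_mod_cast this
          linarith
        exact abs_theta_sub_le_Ico (by omega) hnoprime (hleft hp2657) (hrightEnd hp2657) hxp hxp'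

/-! ### The run -/

/-- **Soundness of a run** along the table cursor. [cite: LeeNosal2026, Thm. 1.2 (finite-range certificate)] -/
theorem run_sound : ∀ (fuel : ℕ) {s s' : TS}, Inv s → run fuel s (after s.p table) = some s' →
    Inv s'
  | 0, s, s', hI, h => by
      simp only [run, Option.some.injEq] at h
      exact h ▸ hI
  | fuel + 1, s, s', hI, h => by
      rcases hseg : after s.p table with _ | ⟨p', rest⟩
      · rw [hseg] at h
        simp only [run, Option.some.injEq] at h
        exact h ▸ hI
      · rw [hseg] at h
        simp only [run] at h
        rcases hst : step s p' with _ | s₁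
        · rw [hst] at h; simp at h
        · rw [hst] at h
          simp only at h
          obtain ⟨hI₁, hp₁⟩ := step_inv hI hseg hst
          have hrest : rest = after s₁.p table := by
            rw [hp₁]; exact tail_after tableOK.sorted hseg
          rw [hrest] at h
          exact run_sound fuel hI₁ h

/-- **The initial state satisfies the invariant** (`θ(2) = log 2`).
[cite: LeeNosal2026, Thm. 1.2 (finite-range certificate)] -/
theorem initS_inv : Inv initS := by
  refine ⟨tableOK.two_mem, Nat.prime_two, ?_, ?_, ?_, ?_, ?_, ?_, ?_⟩
  · simpa [initS] using L2LON_le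
  · simpa [initS] using le_L2HIN
  · simp only [initS]; push_cast; rw [theta_two]; exact L2LON_le
  · simp only [initS]; push_cast; rw [theta_two]; exact le_L2HIN
  · simp [initS]
  · simp [initS]
  · intro x hx hx2
    simp only [initS] at hx2
    push_cast at hx2
    linarith

/-! ### The window `2657 ≤ x ≤ 3511`, and Theorem 1.2 (`θ`) for all `x ≥ 2657` modulo Büthe -/

/-- **Lee–Nosal's `θ`-inequality on `2657 ≤ x ≤ 3511`, unconditionally, by kernel computation**:
`|θ(x) − x| ≤ √x log x (log x − log log x)/(8π)`. [cite: LeeNosal2026, Thm. 1.2] -/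
theorem abs_theta_sub_le_window {x : ℝ} (hx : 2657 ≤ x) (hxP : x ≤ 3511) :
    |θ x - x| ≤ LeeNosal2026.bound x := by
  have hI := run_sound 489 initS_inv runLN
  rcases lt_or_eq_of_le hxP with hlt | heq
  · exact hI.ln x hx (by simpa using hlt)
  · rw [heq, abs_sub_le_iff]
    refine ⟨?_, ?_⟩
    · have := hI.left (by simp); push_cast at this; simpa using this
    · have := hI.right (by simp); push_cast at this; simpa using this

/-- **Lee–Nosal 2026, Theorem 1.2 (`θ`) on its full printed range `x ≥ 2657` — PROVED under RH
modulo Büthe's Theorem 2** (`Buthe2018_thm2_theta`): the window `[2657, 3511]` by the kernel run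
above, `[3500, 10¹⁹]` by Büthe, beyond by the explicit formula (`LeeNosalThm12.theta_of_buthe`).
[cite: LeeNosal2026, Thm. 1.2; Buthe2018, Thm. 2] -/
theorem LeeNosal2026_theta_of_buthe (hB : Buthe2018_thm2_theta) (hRH : RiemannHypothesis) {x : ℝ}
    (hx : 2657 ≤ x) : |θ x - x| ≤ LeeNosal2026.bound x := by
  rcases le_or_gt x 3511 with h | h
  · exact abs_theta_sub_le_window hx h
  · exact LeeNosalThm12.theta_of_buthe hB hRH (by linarith)

end Literature.NumberTheory.LFunctions.LeeNosalThetaChain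

end
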